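import Summits.CriticalPhenomena.Ising3DConformalLimit.Theorems.SynchronousCouplingRotationJoiningQualitativeOfFDDIsotropy
import Summits.CriticalPhenomena.Ising3DConformalLimit.Theorems.SynchronousCouplingRotationJoiningAxis3OfDilationJoinings

/-!
# Route `SynchronousCoupling`, crux `RotationJoining` (stmt-CriticalPhenomena-18763), line `SketchIdeator2`:
the card's `SplittingTransfer` is a theorem, and the crux modulo its open content

From the landed stubs `stub_rateBootstrap` (p159473) and `stub_qualitativeOfFDDIsotropy` (p161377):
* `stub_splittingTransfer : SplittingTransfer` — card C's named transfer
  `DilationJoiningsAxis3 → DilationJoiningsTilted → AsymptoticFDDIsotropy → RotationJoining` holds outright;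
* `rotationJoining_of_dilationJoinings_tilted_fddIsotropy` — the crux `RotationJoining` from the route's own rank-2 crux
  `DilationJoinings` (item stmt-CriticalPhenomena-18762, via the landed `stub_axis3OfDilationJoinings`), the tilted-cell
  dilation joining `DilationJoiningsTilted` and the rate-free finite-window isotropy `AsymptoticFDDIsotropy`: the exact set of
  open statements the line leaves (a CONDITIONAL proof of the crux; it credits nothing by itself).
-/

namespace Summit.CriticalPhenomena.Ising3DConformalLimit.Cruxes.RotationJoining.RateSplitting

/-- **Card C's `SplittingTransfer` holds**: dilation joinings for axis and tilted cells plus `AsymptoticFDDIsotropy` give the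
crux `RotationJoining` (registered sub-goal `stub_splittingTransfer`; composition of the landed `stub_rateBootstrap` and
`stub_qualitativeOfFDDIsotropy`). -/
theorem stub_splittingTransfer : SplittingTransfer :=
  fun h₁ h₂ h₃ => stub_rateBootstrap h₁ h₂ (stub_qualitativeOfFDDIsotropy h₁ h₂ h₃)

/-- **The crux modulo its open content.** `DilationJoinings` (item stmt-CriticalPhenomena-18762) `→ DilationJoiningsTilted →
AsymptoticFDDIsotropy → RotationJoining`. Conditional: the three hypotheses are open statements. -/
theorem rotationJoining_of_dilationJoinings_tilted_fddIsotropy :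
    Summit.CriticalPhenomena.Ising3DConformalLimit.Theses.SynchronousCoupling.DilationJoinings →
      DilationJoiningsTilted → AsymptoticFDDIsotropy →
        Summit.CriticalPhenomena.Ising3DConformalLimit.Theses.SynchronousCoupling.RotationJoining :=
  fun hDJ h₂ h₃ => stub_splittingTransfer (stub_axis3OfDilationJoinings hDJ) h₂ h₃

end Summit.CriticalPhenomena.Ising3DConformalLimit.Cruxes.RotationJoining.RateSplitting
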